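import Summits.QuantumFields.YangMills.Theorems.UnitScaleTiltProp8FibreTangentAvg
import Summits.QuantumFields.YangMills.Theorems.UnitScaleTiltProp8FibreSelectiveCorrector
import HarnessLib

/-!
# Route `UnitScaleTilt`, crux K1 «MinimiserStabilityRegPr» (stmt-QuantumFields-19200), stub `stub_prop8` (V2) — sub-lemma V2-EL, part 7b:
# **LIFTING DIFFERENTIABLE CURVES INTO A MOVING ONE-STEP (0.4)-FIBRE** (`exists_fibre_lift_curve`)

Cell `ym3-torus` ∕ fleet seat `ym-ust-19200-p2` g4.  Generalises part 5b (`exists_tangent_lin_eq_zero`, p508741, g3): there the ambient curve moved ONE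
non-central bond and the target coarse field was CONSTANT.  Here: an arbitrary bondwise-differentiable ambient family `Γ₀(t)` of fine fields through a
small `U₀ = Γ₀(0)` and an arbitrary bondwise-differentiable TARGET family `V(t)` of coarse fields with `V(0) = Ū₀` are given; the conclusion is a
family `γ(t)` with `γ(0) = U₀`, every bond differentiable at `t = 0`, and, for `t` near `0`: `γ̄(t) = V(t)` EXACTLY, `γ(t) = Γ₀(t)` off the central
crossing bonds, and `γ(t) = Γ₀(t)` also at the central bond of every coarse bond `c` at which the target is already met (`V(t)(c) = Γ̄₀(t)(c)`).
This is the induction step of the k-fold tangent space of the (0.4)-descent fibre (part 7c): the moving target is the lifted curve one level up.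
PROOF: as part 5b — selective exact corrector (part 7a) at each good `t`, central coordinates `W_c(t) = pre·γ(t)(βc)·post` solve
`eml(1 | h_i(t)W^*)W − (V(t)(c) − V(0)(c)) = Ū₀(c)`, are Lipschitz at `0` (corrector modulus + differentiability of the data), hence differentiable
(`hasDerivAt_of_implicit_of_lipschitz`, the `W`-derivative being left-invertible by `norm_fibreCoreDeriv_sub_le`).  Sorry-free, no definition. [folklore]
References: T. Bałaban, CMP 102 (1985) 277–309 [Balaban1985Variational] ((127) p.297, p.300); CMP 109 (1987) 249–301 [Balaban1987RG1] ((0.4) p.253).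
-/

noncomputable section

open scoped BigOperators Matrix.Norms.L2Operator Matrix
open Filter Topology Asymptotics NormedSpace Function

namespace Summit.QuantumFields.YangMills.Theorems.Prop8Criticality

open Literature.MathematicalPhysics.QuantumFieldTheory.Balaban1983to89
open T4Continuum AveragingRT BlockAveraging BlockAveragingHaarAC BlockAveragingEMLHaarAC ExpMeanLog
open B7TransferAnalyticMean BlockAveragingEMLAnalyticMean
open Summit.QuantumFields.YangMills.Theorems.BlockAvgCorrector (stokesConst stokesConst_nonneg emlWeight_pos emlWeight_le_one
  norm_openHol_mul_star_sub_one_le plaqSmall_of_forall_norm_sub_le)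

variable {P : Params} {j : ℕ}

section Lift

/-- Along a bondwise continuous family through a `t₀`-small field, the loop variables of (0.4) are eventually in the guard and every field is
eventually `2t₀`-small; at `t = 0` they are within `1` of the identity (given `stokesConst·(2t₀) < 1/3`). [cite: Balaban1987RG1, (0.4) p.253] -/
theorem eventually_small_of_tendsto {Γ : ℝ → GaugeField P j (Matrix.specialUnitaryGroup (Fin 2) ℂ)} {t₀ : ℝ} (ht₀ : 0 < t₀)
    (h2t₀ : stokesConst P * (2 * t₀) < 1 / 3) (hU₀ : PlaqSmall t₀ (Γ 0))
    (hcont : ∀ b : PBond P j, Tendsto (fun t : ℝ => (Γ t b : Matrix (Fin 2) (Fin 2) ℂ)) (𝓝 0) (𝓝 (Γ 0 b : Matrix (Fin 2) (Fin 2) ℂ))) :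
    (∀ᶠ t in 𝓝 (0 : ℝ), PlaqSmall (2 * t₀) (Γ t) ∧ ∀ c, Small (expMeanLogSU (n := Fin 2)) (Γ t) c) ∧
      ∀ c i, ‖((loopHol (Γ 0) c i : Matrix.specialUnitaryGroup (Fin 2) ℂ) : Matrix (Fin 2) (Fin 2) ℂ) - 1‖ < 1 := by
  set ε : ℝ → ℝ := fun t => ∑ b : PBond P j, ‖(Γ t b : Matrix (Fin 2) (Fin 2) ℂ) - (Γ 0 b : Matrix (Fin 2) (Fin 2) ℂ)‖ with hε
  have hε0 : ∀ t, 0 ≤ ε t := fun t => Finset.sum_nonneg fun b _ => norm_nonneg _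
  have hdist : ∀ t b, ‖(Γ t b : Matrix (Fin 2) (Fin 2) ℂ) - (Γ 0 b : Matrix (Fin 2) (Fin 2) ℂ)‖ ≤ ε t := fun t b =>
    Finset.single_le_sum (f := fun b => ‖(Γ t b : Matrix (Fin 2) (Fin 2) ℂ) - (Γ 0 b : Matrix (Fin 2) (Fin 2) ℂ)‖) (fun b _ => norm_nonneg _) (Finset.mem_univ b)
  have hεcont : Tendsto ε (𝓝 0) (𝓝 0) := by
    have : Tendsto ε (𝓝 0) (𝓝 (∑ b : PBond P j, ‖(Γ 0 b : Matrix (Fin 2) (Fin 2) ℂ) - (Γ 0 b : Matrix (Fin 2) (Fin 2) ℂ)‖)) :=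
      tendsto_finsetSum _ fun b _ => ((hcont b).sub tendsto_const_nhds).norm
    simpa using this
  have hεev : ∀ᶠ t in 𝓝 (0 : ℝ), ε t ≤ t₀ / 4 := by
    have := (Metric.tendsto_nhds.mp hεcont) (t₀ / 4) (by positivity)
    filter_upwards [this] with t ht
    rw [Real.dist_eq, sub_zero, abs_of_nonneg (hε0 t)] at ht
    exact ht.le
  have hδ : (expMeanLogSU (n := Fin 2)).δ = 1 / 3 := expMeanLogSU_two_δ
  refine ⟨?_, ?_⟩
  · filter_upwards [hεev] with t ht
    have hplaq : PlaqSmall (2 * t₀) (Γ t) := fun p => (plaqSmall_of_forall_norm_sub_le hU₀ (hdist t) p).trans_le (by linarith)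
    refine ⟨hplaq, fun c i => ?_⟩
    have h1 := LatticeWordStokes.dist1_loopHol_le (by positivity : (0 : ℝ) ≤ 2 * t₀) hplaq c i
    rw [hδ]
    exact h1.trans_lt h2t₀
  · intro c i
    have h1 := LatticeWordStokes.dist1_loopHol_le ht₀.le hU₀ c i
    rw [SU2Mean.dist1_eq_norm] at h1
    refine h1.trans_lt ?_
    show stokesConst P * t₀ < 1
    have : stokesConst P * (2 * t₀) = 2 * (stokesConst P * t₀) := by ring
    have := stokesConst_nonneg P
    nlinarith

/-- **LIFTING DIFFERENTIABLE CURVES INTO A MOVING ONE-STEP FIBRE OF (0.4).**  Let `Γ₀(t)` be a family of fine `SU(2)` fields, every bond differentiable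
at `t = 0`, through a `t₀`-small `U₀ = Γ₀(0)` with `stokesConst·t₀ ≤ |I|⁻¹/1000`, and let `V(t)` be a family of coarse fields, every bond differentiable
at `t = 0`, with `V(0) = Ū₀`.  Then there is a family `γ(t)` of fine fields with `γ(0) = U₀`, every bond differentiable at `t = 0`, and for `t` near `0`:
`γ̄(t) = V(t)` exactly; `γ(t) = Γ₀(t)` at every non-central bond; and `γ(t)(β c) = Γ₀(t)(β c)` at every coarse bond `c` with `V(t)(c) = Γ̄₀(t)(c)`.
[cite: Balaban1985Variational, (127) p.297; Balaban1987RG1, (0.4) p.253] -/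
theorem exists_fibre_lift_curve [DecidableEq (PBond P j)] (hj : j + 1 ≤ P.m + P.K) {t₀ : ℝ} (ht₀ : 0 < t₀)
    (hsmall : stokesConst P * t₀ ≤ emlWeight P / 1000)
    (Γ₀ : ℝ → GaugeField P j (Matrix.specialUnitaryGroup (Fin 2) ℂ))
    (hΓ₀diff : ∀ b : PBond P j, DifferentiableAt ℝ (fun t : ℝ => (Γ₀ t b : Matrix (Fin 2) (Fin 2) ℂ)) 0)
    (hU₀ : PlaqSmall t₀ (Γ₀ 0))
    (Vt : ℝ → GaugeField P (j + 1) (Matrix.specialUnitaryGroup (Fin 2) ℂ))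
    (hVtdiff : ∀ c : PBond P (j + 1), DifferentiableAt ℝ (fun t : ℝ => ((Vt t c : Matrix.specialUnitaryGroup (Fin 2) ℂ) : Matrix (Fin 2) (Fin 2) ℂ)) 0)
    (hVt0 : Vt 0 = avgFun (expMeanLogSU (n := Fin 2)) (Γ₀ 0)) :
    ∃ γ : ℝ → GaugeField P j (Matrix.specialUnitaryGroup (Fin 2) ℂ),
      γ 0 = Γ₀ 0 ∧
      (∀ b : PBond P j, DifferentiableAt ℝ (fun t : ℝ => (γ t b : Matrix (Fin 2) (Fin 2) ℂ)) 0) ∧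
      ∀ᶠ t in 𝓝 (0 : ℝ), avgFun (expMeanLogSU (n := Fin 2)) (γ t) = Vt t ∧
        (∀ b : PBond P j, (∀ c : PBond P (j + 1), centralBond c ≠ b) → γ t b = Γ₀ t b) ∧
        (∀ c : PBond P (j + 1), Vt t c = avgFun (expMeanLogSU (n := Fin 2)) (Γ₀ t) c → γ t (centralBond c) = Γ₀ t (centralBond c)) := by
  set ℰ : LoopAverage (Matrix.specialUnitaryGroup (Fin 2) ℂ) := expMeanLogSU (n := Fin 2) with hℰ
  set κ : ℝ := emlWeight P with hκdef
  have hκ : 0 < κ := emlWeight_pos P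
  have hκ1 : κ ≤ 1 := emlWeight_le_one P
  have hst : 0 ≤ stokesConst P := stokesConst_nonneg P
  have hδ : ℰ.δ = 1 / 3 := expMeanLogSU_two_δ
  have hΓ₀cont : ∀ b : PBond P j, Tendsto (fun t : ℝ => (Γ₀ t b : Matrix (Fin 2) (Fin 2) ℂ)) (𝓝 0) (𝓝 (Γ₀ 0 b : Matrix (Fin 2) (Fin 2) ℂ)) :=
    fun b => (hΓ₀diff b).continuousAt.tendsto
  have h2t₀ : stokesConst P * (2 * t₀) ≤ κ / 500 := by nlinarith
  have h2t₀' : stokesConst P * (2 * t₀) < 1 / 3 := by linarith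
  obtain ⟨hsmallev, hloop0⟩ := eventually_small_of_tendsto ht₀ h2t₀' hU₀ hΓ₀cont
  -- the defect `η(t) = Σ_c ‖V(t)(c) − Γ̄₀(t)(c)‖ = O(t)`
  set η : ℝ → ℝ := fun t => ∑ c : PBond P (j + 1),
    ‖((Vt t c : Matrix.specialUnitaryGroup (Fin 2) ℂ) : Matrix (Fin 2) (Fin 2) ℂ) - ((avgFun ℰ (Γ₀ t) c : Matrix.specialUnitaryGroup (Fin 2) ℂ) : Matrix (Fin 2) (Fin 2) ℂ)‖ with hη
  have hη0 : ∀ t, 0 ≤ η t := fun t => Finset.sum_nonneg fun c _ => norm_nonneg _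
  have hηc : ∀ t c, ‖((Vt t c : Matrix.specialUnitaryGroup (Fin 2) ℂ) : Matrix (Fin 2) (Fin 2) ℂ)
      - ((avgFun ℰ (Γ₀ t) c : Matrix.specialUnitaryGroup (Fin 2) ℂ) : Matrix (Fin 2) (Fin 2) ℂ)‖ ≤ η t := fun t c =>
    Finset.single_le_sum (f := fun c => ‖((Vt t c : Matrix.specialUnitaryGroup (Fin 2) ℂ) : Matrix (Fin 2) (Fin 2) ℂ)
      - ((avgFun ℰ (Γ₀ t) c : Matrix.specialUnitaryGroup (Fin 2) ℂ) : Matrix (Fin 2) (Fin 2) ℂ)‖) (fun c _ => norm_nonneg _) (Finset.mem_univ c)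
  have hη00 : η 0 = 0 := by
    simp only [hη, hVt0, sub_self, norm_zero, Finset.sum_const_zero]
  have havgdiff : ∀ c, DifferentiableAt ℝ (fun t : ℝ => ((avgFun ℰ (Γ₀ t) c : Matrix.specialUnitaryGroup (Fin 2) ℂ) : Matrix (Fin 2) (Fin 2) ℂ)) 0 :=
    fun c => differentiableAt_coe_avgFun hΓ₀diff c (hsmallev.mono fun t ht => ht.2 c) (hloop0 c)
  obtain ⟨Cη, hCη0, hηbound⟩ : ∃ C : ℝ, 0 ≤ C ∧ ∀ᶠ t in 𝓝 (0 : ℝ), η t ≤ C * |t| := by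
    have hc := fun c => eventually_norm_sub_le_mul_of_differentiableAt ((hVtdiff c).sub (havgdiff c))
    choose Cc hCc0 hCc using hc
    refine ⟨∑ c, Cc c, Finset.sum_nonneg fun c _ => hCc0 c, ?_⟩
    filter_upwards [Filter.eventually_all.mpr hCc] with t ht
    rw [hη, Finset.sum_mul]
    refine Finset.sum_le_sum fun c _ => ?_
    have h1 := ht c
    have h0 : ((Vt 0 c : Matrix.specialUnitaryGroup (Fin 2) ℂ) : Matrix (Fin 2) (Fin 2) ℂ) - ((avgFun ℰ (Γ₀ 0) c : Matrix.specialUnitaryGroup (Fin 2) ℂ) : Matrix (Fin 2) (Fin 2) ℂ) = 0 := by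
      rw [hVt0, sub_self]
    simp only [Pi.sub_apply] at h1
    rw [h0, sub_zero] at h1
    exact h1
  have hηcont : Tendsto η (𝓝 0) (𝓝 0) := by
    refine squeeze_zero' (Filter.Eventually.of_forall hη0) hηbound ?_
    have : Tendsto (fun t : ℝ => Cη * |t|) (𝓝 0) (𝓝 (Cη * |(0 : ℝ)|)) := (continuous_const.mul continuous_abs).tendsto 0
    simpa using this
  -- the good parameters
  set good : ℝ → Prop := fun t => (PlaqSmall (2 * t₀) (Γ₀ t) ∧ ∀ c, Small ℰ (Γ₀ t) c) ∧ stokesConst P * (2 * t₀) + 2 * η t / κ ≤ κ / 16 ∧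
    stokesConst P * (2 * t₀ + 4 * (2 * η t / κ)) < 1 / 3 with hgood
  have hgood0 : good 0 := by
    refine ⟨⟨fun p => lt_of_lt_of_le (hU₀ p) (by linarith : t₀ ≤ 2 * t₀), fun c i => ?_⟩, ?_, ?_⟩
    · have h1 := LatticeWordStokes.dist1_loopHol_le ht₀.le hU₀ c i
      rw [hδ]; refine h1.trans_lt ?_; show stokesConst P * t₀ < 1 / 3; nlinarith
    · rw [hη00]; simp only [mul_zero, zero_div, add_zero]; linarith
    · rw [hη00]; simp only [mul_zero, zero_div, add_zero]; linarith
  have hgoodev : ∀ᶠ t in 𝓝 (0 : ℝ), good t := by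
    have h1 : ∀ᶠ t in 𝓝 (0 : ℝ), η t ≤ κ * κ / 64 := by
      have := (Metric.tendsto_nhds.mp hηcont) (κ * κ / 64) (by positivity)
      filter_upwards [this] with t ht
      rw [Real.dist_eq, sub_zero, abs_of_nonneg (hη0 t)] at ht
      exact ht.le
    have h2 : ∀ᶠ t in 𝓝 (0 : ℝ), η t ≤ κ / (64 * (stokesConst P + 1)) := by
      have := (Metric.tendsto_nhds.mp hηcont) (κ / (64 * (stokesConst P + 1))) (by positivity)
      filter_upwards [this] with t ht
      rw [Real.dist_eq, sub_zero, abs_of_nonneg (hη0 t)] at ht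
      exact ht.le
    filter_upwards [hsmallev, h1, h2] with t ht h1t h2t
    refine ⟨ht, ?_, ?_⟩
    · have : 2 * η t / κ ≤ κ / 32 := by
        rw [div_le_iff₀ hκ]; nlinarith
      linarith
    · have h2t' : η t * (64 * (stokesConst P + 1)) ≤ κ := (le_div_iff₀ (by positivity)).mp h2t
      have e1 : stokesConst P * (4 * (2 * η t / κ)) ≤ 1 / 8 := by
        rw [show stokesConst P * (4 * (2 * η t / κ)) = (8 * stokesConst P * η t) / κ by ring, div_le_iff₀ hκ]
        nlinarith [hη0 t]
      have e2 : stokesConst P * (2 * t₀ + 4 * (2 * η t / κ)) = stokesConst P * (2 * t₀) + stokesConst P * (4 * (2 * η t / κ)) := by ring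
      rw [e2]
      linarith
  -- the selective corrector at every good parameter
  have hcorr : ∀ t, good t → ∃ U' : GaugeField P j (Matrix.specialUnitaryGroup (Fin 2) ℂ), avgFun ℰ U' = Vt t ∧
      (∀ b, (∀ c, centralBond c ≠ b) → U' b = Γ₀ t b) ∧
      (∀ c, Vt t c = avgFun ℰ (Γ₀ t) c → U' (centralBond c) = Γ₀ t (centralBond c)) ∧
      ∀ b, ‖((U' b : Matrix.specialUnitaryGroup (Fin 2) ℂ) : Matrix (Fin 2) (Fin 2) ℂ) - (Γ₀ t b : Matrix (Fin 2) (Fin 2) ℂ)‖ ≤ 2 * η t / κ := by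
    intro t ht
    have h2t : (0 : ℝ) ≤ 2 * t₀ := by positivity
    have hguard : stokesConst P * (2 * t₀) + 2 * η t / emlWeight P < (expMeanLogSU (n := Fin 2)).δ := by
      rw [expMeanLogSU_two_δ]; have := ht.2.1; linarith
    exact exists_avgFun_eq_of_near_selective (n := Fin 2) hj h2t (hη0 t) ht.2.1 hguard (Γ₀ t) ht.1.1 (Vt t) (hηc t)
  have hγex : ∀ t, ∃ U' : GaugeField P j (Matrix.specialUnitaryGroup (Fin 2) ℂ), good t → (avgFun ℰ U' = Vt t ∧
      (∀ b, (∀ c, centralBond c ≠ b) → U' b = Γ₀ t b) ∧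
      (∀ c, Vt t c = avgFun ℰ (Γ₀ t) c → U' (centralBond c) = Γ₀ t (centralBond c)) ∧
      ∀ b, ‖((U' b : Matrix.specialUnitaryGroup (Fin 2) ℂ) : Matrix (Fin 2) (Fin 2) ℂ) - (Γ₀ t b : Matrix (Fin 2) (Fin 2) ℂ)‖ ≤ 2 * η t / κ) := by
    intro t
    by_cases ht : good t
    · obtain ⟨U', hU'⟩ := hcorr t ht
      exact ⟨U', fun _ => hU'⟩
    · exact ⟨Γ₀ 0, fun h => absurd h ht⟩
  choose γ hγspec using hγex
  have hγ0 : γ 0 = Γ₀ 0 := by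
    funext b
    have h1 := (hγspec 0 hgood0).2.2.2 b
    rw [hη00, mul_zero, zero_div] at h1
    exact Subtype.ext (sub_eq_zero.mp (norm_le_zero_iff.mp h1))
  -- the central coordinates and the (target-shifted) guarded fibre map
  set W : PBond P (j + 1) → ℝ → Matrix (Fin 2) (Fin 2) ℂ := fun c t =>
    ((pre (Γ₀ t) c : Matrix.specialUnitaryGroup (Fin 2) ℂ) : Matrix (Fin 2) (Fin 2) ℂ) * (γ t (centralBond c) : Matrix (Fin 2) (Fin 2) ℂ)
      * ((post (Γ₀ t) c : Matrix.specialUnitaryGroup (Fin 2) ℂ) : Matrix (Fin 2) (Fin 2) ℂ) with hWdef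
  set G : PBond P (j + 1) → Matrix (Fin 2) (Fin 2) ℂ × ℝ → Matrix (Fin 2) (Fin 2) ℂ := fun c p =>
    eml (fun i => if IsCentral c i then (1 : Matrix (Fin 2) (Fin 2) ℂ) else
      ((openHol (Γ₀ p.2) c i : Matrix.specialUnitaryGroup (Fin 2) ℂ) : Matrix (Fin 2) (Fin 2) ℂ) * star p.1) * p.1 with hGdef
  set D : PBond P (j + 1) → Matrix (Fin 2) (Fin 2) ℂ × ℝ → Matrix (Fin 2) (Fin 2) ℂ := fun c p =>
    ((Vt p.2 c : Matrix.specialUnitaryGroup (Fin 2) ℂ) : Matrix (Fin 2) (Fin 2) ℂ) - ((Vt 0 c : Matrix.specialUnitaryGroup (Fin 2) ℂ) : Matrix (Fin 2) (Fin 2) ℂ) with hDdef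
  clear_value W G D
  have hGV : ∀ c t, good t → G c (W c t, t) = ((Vt t c : Matrix.specialUnitaryGroup (Fin 2) ℂ) : Matrix (Fin 2) (Fin 2) ℂ) := by
    intro c t ht
    obtain ⟨hV', hoff, -, hdist⟩ := hγspec t ht
    have hupd : ∀ b, ‖((update (Γ₀ t) (centralBond c) (γ t (centralBond c)) b : Matrix.specialUnitaryGroup (Fin 2) ℂ) : Matrix (Fin 2) (Fin 2) ℂ)
        - (Γ₀ t b : Matrix (Fin 2) (Fin 2) ℂ)‖ ≤ 2 * η t / κ := by
      intro b
      by_cases hb : b = centralBond c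
      · subst hb; rw [update_self]; exact hdist _
      · rw [update_of_ne hb, sub_self, norm_zero]; exact div_nonneg (by linarith [hη0 t]) hκ.le
    have hplaqu : PlaqSmall (2 * t₀ + 4 * (2 * η t / κ)) (update (Γ₀ t) (centralBond c) (γ t (centralBond c))) :=
      plaqSmall_of_forall_norm_sub_le ht.1.1 hupd
    have hsmu : Small ℰ (update (Γ₀ t) (centralBond c) (γ t (centralBond c))) c := by
      intro i
      have h2pos : (0 : ℝ) ≤ 2 * t₀ + 4 * (2 * η t / κ) := by
        have := hη0 t
        have : 0 ≤ 2 * η t / κ := div_nonneg (by linarith) hκ.le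
        linarith
      have h1 := LatticeWordStokes.dist1_loopHol_le h2pos hplaqu c i
      rw [hδ]
      exact h1.trans_lt ht.2.2
    rw [← hV', avgFun_eq_avgFun_update_of_agree hj ℰ (Γ₀ t) (γ t) c hoff, hGdef, hWdef,
      coe_avgFun_update_centralBond hj (Γ₀ t) c (γ t (centralBond c)) hsmu]
  have hsol : ∀ c, ∀ᶠ t in 𝓝 (0 : ℝ), G c (W c t, t) - D c (W c t, t) = G c (W c 0, 0) - D c (W c 0, 0) := fun c => by
    filter_upwards [hgoodev] with t ht
    rw [hGV c t ht, hGV c 0 hgood0, hDdef]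
    simp only [sub_self, sub_zero, sub_sub_cancel]
  have hW0 : ∀ c, W c 0 = ((axialAvg (Γ₀ 0) c : Matrix.specialUnitaryGroup (Fin 2) ℂ) : Matrix (Fin 2) (Fin 2) ℂ) := fun c => by
    rw [hWdef]
    simp only [hγ0]
    rw [axialAvg_eq_pre_mul_mul_post, Submonoid.coe_mul, Submonoid.coe_mul]
  have hprediff : ∀ c, DifferentiableAt ℝ (fun t : ℝ => ((pre (Γ₀ t) c : Matrix.specialUnitaryGroup (Fin 2) ℂ) : Matrix (Fin 2) (Fin 2) ℂ)) 0 := fun c => by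
    unfold BlockAveragingHaarAC.pre; exact differentiableAt_coe_holAt hΓ₀diff _
  have hpostdiff : ∀ c, DifferentiableAt ℝ (fun t : ℝ => ((post (Γ₀ t) c : Matrix.specialUnitaryGroup (Fin 2) ℂ) : Matrix (Fin 2) (Fin 2) ℂ)) 0 := fun c => by
    unfold BlockAveragingHaarAC.post; exact differentiableAt_coe_holAt hΓ₀diff _
  have hopendiff : ∀ c i, DifferentiableAt ℝ (fun t : ℝ => ((openHol (Γ₀ t) c i : Matrix.specialUnitaryGroup (Fin 2) ℂ) : Matrix (Fin 2) (Fin 2) ℂ)) 0 := fun c i => by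
    unfold BlockAveragingHaarAC.openHol; exact differentiableAt_coe_holAt hΓ₀diff _
  -- the central bonds of `Γ₀` are Lipschitz at `0`, hence so are the re-solved ones
  have hLip : ∀ c, ∃ C : ℝ, ∀ᶠ t in 𝓝 (0 : ℝ), ‖W c t - W c 0‖ ≤ C * |t| := by
    intro c
    obtain ⟨C₁, -, h₁⟩ := eventually_norm_sub_le_mul_of_differentiableAt (hprediff c)
    obtain ⟨C₂, -, h₂⟩ := eventually_norm_sub_le_mul_of_differentiableAt (hpostdiff c)
    obtain ⟨C₃, -, h₃⟩ := eventually_norm_sub_le_mul_of_differentiableAt (hΓ₀diff (centralBond c))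
    refine ⟨C₁ + (2 * Cη / κ + C₃) + C₂, ?_⟩
    filter_upwards [h₁, h₂, h₃, hgoodev, hηbound] with t ht₁ ht₂ ht₃ ht hηt
    have hmid : ‖((γ t (centralBond c) : Matrix.specialUnitaryGroup (Fin 2) ℂ) : Matrix (Fin 2) (Fin 2) ℂ) - ((γ 0 (centralBond c) : Matrix.specialUnitaryGroup (Fin 2) ℂ) : Matrix (Fin 2) (Fin 2) ℂ)‖
        ≤ (2 * Cη / κ + C₃) * |t| := by
      have h1 := (hγspec t ht).2.2.2 (centralBond c)
      rw [hγ0]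
      calc _ ≤ ‖((γ t (centralBond c) : Matrix.specialUnitaryGroup (Fin 2) ℂ) : Matrix (Fin 2) (Fin 2) ℂ) - (Γ₀ t (centralBond c) : Matrix (Fin 2) (Fin 2) ℂ)‖
            + ‖((Γ₀ t (centralBond c) : Matrix.specialUnitaryGroup (Fin 2) ℂ) : Matrix (Fin 2) (Fin 2) ℂ) - (Γ₀ 0 (centralBond c) : Matrix (Fin 2) (Fin 2) ℂ)‖ :=
            norm_sub_le_norm_sub_add_norm_sub _ _ _
        _ ≤ 2 * η t / κ + C₃ * |t| := add_le_add h1 ht₃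
        _ ≤ 2 * (Cη * |t|) / κ + C₃ * |t| := by gcongr
        _ = (2 * Cη / κ + C₃) * |t| := by ring
    rw [hWdef]
    calc _ ≤ ‖((pre (Γ₀ t) c : Matrix.specialUnitaryGroup (Fin 2) ℂ) : Matrix (Fin 2) (Fin 2) ℂ) - ((pre (Γ₀ 0) c : Matrix.specialUnitaryGroup (Fin 2) ℂ) : Matrix (Fin 2) (Fin 2) ℂ)‖
          + ‖((γ t (centralBond c) : Matrix.specialUnitaryGroup (Fin 2) ℂ) : Matrix (Fin 2) (Fin 2) ℂ) - ((γ 0 (centralBond c) : Matrix.specialUnitaryGroup (Fin 2) ℂ) : Matrix (Fin 2) (Fin 2) ℂ)‖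
          + ‖((post (Γ₀ t) c : Matrix.specialUnitaryGroup (Fin 2) ℂ) : Matrix (Fin 2) (Fin 2) ℂ) - ((post (Γ₀ 0) c : Matrix.specialUnitaryGroup (Fin 2) ℂ) : Matrix (Fin 2) (Fin 2) ℂ)‖ :=
          norm_mul_mul_sub_le (norm_coe_su2 _).le (norm_coe_su2 _).le (norm_coe_su2 _).le (norm_coe_su2 _).le
      _ ≤ C₁ * |t| + (2 * Cη / κ + C₃) * |t| + C₂ * |t| := add_le_add (add_le_add ht₁ hmid) ht₂
      _ = (C₁ + (2 * Cη / κ + C₃) + C₂) * |t| := by ring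
  have hv24 : stokesConst P * t₀ ≤ 1 / 24 := by nlinarith
  have hθ : ∀ c : PBond P (j + 1), (((Finset.univ.filter fun i => ¬ IsCentral c i).card : ℝ)) / (Fintype.card (Idx P) : ℝ) ≤ 1 - κ :=
    fun c => offCentral_ratio_le c
  have hWdiff : ∀ c, DifferentiableAt ℝ (W c) 0 := by
    intro c
    have hW0u : W c 0 ∈ Matrix.unitaryGroup (Fin 2) ℂ := by rw [hW0 c]; exact (axialAvg (Γ₀ 0) c).2.1
    have hhu : ∀ i, ¬ IsCentral c i →
        ((openHol (Γ₀ 0) c i : Matrix.specialUnitaryGroup (Fin 2) ℂ) : Matrix (Fin 2) (Fin 2) ℂ) ∈ Matrix.unitaryGroup (Fin 2) ℂ :=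
      fun i _ => (openHol (Γ₀ 0) c i).2.1
    have hTi : ∀ i, ‖(if IsCentral c i then (1 : Matrix (Fin 2) (Fin 2) ℂ) else
        ((openHol (Γ₀ 0) c i : Matrix.specialUnitaryGroup (Fin 2) ℂ) : Matrix (Fin 2) (Fin 2) ℂ) * star (W c 0)) - 1‖ ≤ stokesConst P * t₀ := by
      intro i
      split_ifs with hc
      · rw [sub_self, norm_zero]; positivity
      · rw [hW0 c]; exact norm_openHol_mul_star_sub_one_le ht₀.le hU₀ c i
    have hTsup : ‖(fun i => if IsCentral c i then (1 : Matrix (Fin 2) (Fin 2) ℂ) else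
        ((openHol (Γ₀ 0) c i : Matrix.specialUnitaryGroup (Fin 2) ℂ) : Matrix (Fin 2) (Fin 2) ℂ) * star (W c 0)) - 1‖ ≤ stokesConst P * t₀ := by
      refine (pi_norm_le_iff_of_nonneg (by positivity)).mpr fun i => ?_
      rw [Pi.sub_apply, Pi.one_apply]; exact hTi i
    have hT13 : ‖(fun i => if IsCentral c i then (1 : Matrix (Fin 2) (Fin 2) ℂ) else
        ((openHol (Γ₀ 0) c i : Matrix.specialUnitaryGroup (Fin 2) ℂ) : Matrix (Fin 2) (Fin 2) ℂ) * star (W c 0)) - 1‖ < 1 / 3 :=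
      hTsup.trans_lt (by linarith)
    have hT1 : ∀ i, ‖(if IsCentral c i then (1 : Matrix (Fin 2) (Fin 2) ℂ) else
        ((openHol (Γ₀ 0) c i : Matrix.specialUnitaryGroup (Fin 2) ℂ) : Matrix (Fin 2) (Fin 2) ℂ) * star (W c 0)) - 1‖ < 1 :=
      fun i => (hTi i).trans_lt (by linarith)
    -- differentiability of the fibre map, of the target shift, and the partial derivative in the coordinate
    have hGd : DifferentiableAt ℝ (G c) (W c 0, 0) := by
      rw [hGdef]
      exact differentiableAt_fibreCore_param (IsCentral c)
        (fun t i => ((openHol (Γ₀ t) c i : Matrix.specialUnitaryGroup (Fin 2) ℂ) : Matrix (Fin 2) (Fin 2) ℂ)) (W c 0) (hopendiff c) hT1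
    set Dlin : Matrix (Fin 2) (Fin 2) ℂ × ℝ →L[ℝ] Matrix (Fin 2) (Fin 2) ℂ :=
      (fderiv ℝ (fun t : ℝ => ((Vt t c : Matrix.specialUnitaryGroup (Fin 2) ℂ) : Matrix (Fin 2) (Fin 2) ℂ)) 0).comp
        (ContinuousLinearMap.snd ℝ (Matrix (Fin 2) (Fin 2) ℂ) ℝ) with hDlin
    have hDd : HasFDerivAt (D c) Dlin (W c 0, 0) := by
      have h1 : HasFDerivAt (fun t : ℝ => ((Vt t c : Matrix.specialUnitaryGroup (Fin 2) ℂ) : Matrix (Fin 2) (Fin 2) ℂ))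
          (fderiv ℝ (fun t : ℝ => ((Vt t c : Matrix.specialUnitaryGroup (Fin 2) ℂ) : Matrix (Fin 2) (Fin 2) ℂ)) 0)
          (((W c 0, (0 : ℝ)) : Matrix (Fin 2) (Fin 2) ℂ × ℝ).2) := (hVtdiff c).hasFDerivAt
      have h2 : HasFDerivAt (fun p : Matrix (Fin 2) (Fin 2) ℂ × ℝ => ((Vt p.2 c : Matrix.specialUnitaryGroup (Fin 2) ℂ) : Matrix (Fin 2) (Fin 2) ℂ))
          Dlin (W c 0, 0) := h1.comp (W c 0, (0 : ℝ)) hasFDerivAt_snd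
      have h3 := h2.sub_const (((Vt 0 c : Matrix.specialUnitaryGroup (Fin 2) ℂ) : Matrix (Fin 2) (Fin 2) ℂ))
      rw [hDdef]
      exact h3
    have hDlin0 : ∀ X : Matrix (Fin 2) (Fin 2) ℂ, Dlin (X, 0) = 0 := fun X => by
      rw [hDlin, ContinuousLinearMap.comp_apply, ContinuousLinearMap.coe_snd', map_zero]
    have hA : HasFDerivAt (fun p => G c p - D c p) (fderiv ℝ (G c) (W c 0, 0) - Dlin) (W c 0, 0) := hGd.hasFDerivAt.sub hDd
    have hinl : ∀ X, fderiv ℝ (G c) (W c 0, 0) (X, 0)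
        = fderiv ℂ (eml : (Idx P → Matrix (Fin 2) (Fin 2) ℂ) → Matrix (Fin 2) (Fin 2) ℂ)
            (fun i => if IsCentral c i then (1 : Matrix (Fin 2) (Fin 2) ℂ) else
              ((openHol (Γ₀ 0) c i : Matrix.specialUnitaryGroup (Fin 2) ℂ) : Matrix (Fin 2) (Fin 2) ℂ) * star (W c 0))
            (fun i => if IsCentral c i then (0 : Matrix (Fin 2) (Fin 2) ℂ) else
              ((openHol (Γ₀ 0) c i : Matrix.specialUnitaryGroup (Fin 2) ℂ) : Matrix (Fin 2) (Fin 2) ℂ) * star X) * W c 0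
          + eml (fun i => if IsCentral c i then (1 : Matrix (Fin 2) (Fin 2) ℂ) else
              ((openHol (Γ₀ 0) c i : Matrix.specialUnitaryGroup (Fin 2) ℂ) : Matrix (Fin 2) (Fin 2) ℂ) * star (W c 0)) * X := by
      intro X
      rw [hGdef]
      exact fderiv_fibreCore_param_inl (IsCentral c)
        (fun t i => ((openHol (Γ₀ t) c i : Matrix.specialUnitaryGroup (Fin 2) ℂ) : Matrix (Fin 2) (Fin 2) ℂ)) (W c 0) (hopendiff c) hT13 X
    obtain ⟨A₁, hA₁apply⟩ : ∃ A₁ : Matrix (Fin 2) (Fin 2) ℂ →L[ℝ] Matrix (Fin 2) (Fin 2) ℂ,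
        ∀ X, A₁ X = fderiv ℝ (G c) (W c 0, 0) (X, 0) := by
      generalize fderiv ℝ (G c) (W c 0, 0) = A
      refine ⟨LinearMap.toContinuousLinearMap
        { toFun := fun X => A (X, 0)
          map_add' := fun X Y => by rw [← map_add, Prod.mk_add_mk, add_zero]
          map_smul' := fun r X => by rw [RingHom.id_apply, ← ContinuousLinearMap.map_smul, Prod.smul_mk, smul_zero] }, fun X => ?_⟩
      rw [LinearMap.coe_toContinuousLinearMap']
      rfl
    have hbound : ∀ X : Matrix (Fin 2) (Fin 2) ℂ, κ / 2 * ‖X‖ ≤ ‖A₁ X‖ := by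
      intro X
      rw [hA₁apply, hinl X]
      have hest := norm_fibreCoreDeriv_sub_le (IsCentral c)
        (fun i => ((openHol (Γ₀ 0) c i : Matrix.specialUnitaryGroup (Fin 2) ℂ) : Matrix (Fin 2) (Fin 2) ℂ)) hhu hW0u X hTsup hv24
      have hθ0 : (0 : ℝ) ≤ (((Finset.univ.filter fun i => ¬ IsCentral c i).card : ℝ)) / (Fintype.card (Idx P) : ℝ) :=
        div_nonneg (Nat.cast_nonneg _) (Nat.cast_nonneg _)
      have hcast : ((((Finset.univ.filter fun i => ¬ IsCentral c i).card : ℝ)) : ℂ) / ((Fintype.card (Idx P) : ℝ) : ℂ)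
          = (((((Finset.univ.filter fun i => ¬ IsCentral c i).card : ℝ)) / (Fintype.card (Idx P) : ℝ) : ℝ) : ℂ) := by
        rw [Complex.ofReal_div]
      rw [hcast] at hest
      exact half_mul_norm_le_of_near hest (norm_smul_conj_star_eq hW0u X hθ0) (hθ c) hsmall
    obtain ⟨B, hB⟩ := exists_leftInverse_of_bound _ (half_pos hκ) hbound
    have hB' : ∀ X : Matrix (Fin 2) (Fin 2) ℂ, B ((fderiv ℝ (G c) (W c 0, 0) - Dlin) (X, 0)) = X := fun X => by
      have := hB X
      rw [hA₁apply] at this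
      rwa [sub_apply, hDlin0, sub_zero]
    obtain ⟨C, hC⟩ := hLip c
    exact (hasDerivAt_of_implicit_of_lipschitz hA hB' rfl (hsol c) hC).differentiableAt
  have hcentral : ∀ c t, ((γ t (centralBond c) : Matrix.specialUnitaryGroup (Fin 2) ℂ) : Matrix (Fin 2) (Fin 2) ℂ)
      = star ((pre (Γ₀ t) c : Matrix.specialUnitaryGroup (Fin 2) ℂ) : Matrix (Fin 2) (Fin 2) ℂ) * W c t
        * star ((post (Γ₀ t) c : Matrix.specialUnitaryGroup (Fin 2) ℂ) : Matrix (Fin 2) (Fin 2) ℂ) := fun c t => by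
    rw [hWdef]; exact (star_coe_mul_mul_mul_star _ _ _).symm
  have hγdiff : ∀ b : PBond P j, DifferentiableAt ℝ (fun t : ℝ => ((γ t b : Matrix.specialUnitaryGroup (Fin 2) ℂ) : Matrix (Fin 2) (Fin 2) ℂ)) 0 := by
    intro b
    by_cases hb : ∃ c, centralBond c = b
    · obtain ⟨c, rfl⟩ := hb
      have hfun : (fun t : ℝ => ((γ t (centralBond c) : Matrix.specialUnitaryGroup (Fin 2) ℂ) : Matrix (Fin 2) (Fin 2) ℂ))
          = fun t => star ((pre (Γ₀ t) c : Matrix.specialUnitaryGroup (Fin 2) ℂ) : Matrix (Fin 2) (Fin 2) ℂ) * W c t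
            * star ((post (Γ₀ t) c : Matrix.specialUnitaryGroup (Fin 2) ℂ) : Matrix (Fin 2) (Fin 2) ℂ) := funext (hcentral c)
      rw [hfun]
      exact ((hprediff c).star.mul (hWdiff c)).mul (hpostdiff c).star
    · push Not at hb
      refine (hΓ₀diff b).congr_of_eventuallyEq ?_
      filter_upwards [hgoodev] with t ht
      rw [(hγspec t ht).2.1 b (fun c hc => hb c hc)]
  refine ⟨γ, hγ0, hγdiff, ?_⟩
  filter_upwards [hgoodev] with t ht
  exact ⟨(hγspec t ht).1, (hγspec t ht).2.1, (hγspec t ht).2.2.1⟩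

end Lift

end Summit.QuantumFields.YangMills.Theorems.Prop8Criticality

end
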